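import Summits.ValiantsHypothesis.ValiantsHypothesis.Theses.SymmetroidDescartes
import Summits.ValiantsHypothesis.ValiantsHypothesis.Theorems.DerivedPencilRolle.Negative.DerivedPencilRolleFalseOfTriangularClassManyRoots

/-!
# Strategist sketch — crux `DerivedPencilRolleQuasi` (stmt-ValiantsHypothesis-18064), route SymmetroidDescartes

Typed statements quoted in `STRATEGY-CENSUS.md` (planner-cstrat-stmt-ValiantsHypothesis-18064-0, 2026-08-17).
Everything here elaborates; the theorems are sorry-free.  Nothing in this file is a route item.

Contents
* §1 `QCruxWith`, `QuasiRootBound` and the sandwich `QuasiRootBound → crux` (`crux_of_quasiRootBound`, proved);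
  the replication-halving statement `ReplicationHalvingQ` (paper proof in the census §F1).
* §2 the triangular class: `QPencilBound`, `triangular_quasiBound_of_qPencilBound` (proved: the multiplier `C` is
  idle on the class, exactly as for the refuted rev-1 crux), `TriangularClassSuperQuasiRoots` (H′, what a refutation
  must construct) and the negative lemma `derivedPencilRolleQuasi_false_of_H'` (proved).
* §3 strengthenings typed for the census: `BilinearLaw` (the sibling's BMD shape in the crux's own class — FALSE on
  paper by exponent binarisation, census S2), `LogMLogMKLaw` (the binarisation-proof bilinear shape), `CoeffSignLaw`
  (dead: diagonal `g^ℓ`), and the regime fences `FewTermsFree` / `ManyTermsFree` (support targets, Descartes count).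
-/

set_option linter.dupNamespace false
set_option linter.unusedVariables false

namespace Summit.ValiantsHypothesis.ValiantsHypothesis.Cruxes.DerivedPencilRolleQuasi.Strategy

open Summit.ValiantsHypothesis.ValiantsHypothesis.Theses.SymmetroidDescartes
open Summit.ValiantsHypothesis.ValiantsHypothesis.Theorems.SymmetroidDescartes (eval_det_pencil
  card_filter_roots_det_sum_fin_zero)
open Summit.ValiantsHypothesis.ValiantsHypothesis.Theorems.DerivedPencilRolle.Negative (symS symS_isSymm
  symS_det_ne_zero eval_det_symS eval_det_derived_symS_ne_zero)
open scoped BigOperators Matrix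
open Polynomial

/-! ## Vocabulary -/

/-- `Z₊` of the `(K+1)`-term pencil `Σ X^{d l} • S l` (verbatim the crux's left-hand side). -/
noncomputable def posRoots {m K : ℕ} (S : Fin (K + 1) → Matrix (Fin m) (Fin m) ℝ) (d : Fin (K + 1) → ℕ) : ℕ :=
  ((∑ l, (X : ℝ[X]) ^ d l • (S l).map Polynomial.C).det.roots.toFinset.filter (fun t => 0 < t)).card

/-- `Z₊` of the DERIVED `K`-term pencil (verbatim the crux's right-hand count). -/
noncomputable def posRootsDerived {m K : ℕ} (S : Fin (K + 1) → Matrix (Fin m) (Fin m) ℝ)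
    (d : Fin (K + 1) → ℕ) : ℕ :=
  ((∑ l : Fin K, (X : ℝ[X]) ^ (d l.succ - d 0 - 1) •
    (((d l.succ - d 0 : ℕ) : ℝ) • S l.succ).map Polynomial.C).det.roots.toFinset.filter (fun t => 0 < t)).card

/-- The quasi budget `B(m,K) = (K+1)^{A K} · 2^{(log₂ m + 2)^A}`. -/
def budget (A m K : ℕ) : ℕ := (K + 1) ^ (A * K) * 2 ^ (Nat.log 2 m + 2) ^ A

/-- Admissibility: symmetric invertible coefficients, strictly increasing exponents. -/
def Admissible {m K : ℕ} (S : Fin (K + 1) → Matrix (Fin m) (Fin m) ℝ) (d : Fin (K + 1) → ℕ) : Prop :=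
  (∀ l, (S l).IsSymm) ∧ (∀ l, (S l).det ≠ 0) ∧ StrictMono d

/-! ## §1 The crux at fixed constants, the pure bound, the sandwich -/

/-- The crux with its constants exposed. -/
def QCruxWith (C A : ℕ) : Prop :=
  ∀ (m K : ℕ) (S : Fin (K + 1) → Matrix (Fin m) (Fin m) ℝ) (d : Fin (K + 1) → ℕ),
    Admissible S d → posRoots S d ≤ C * posRootsDerived S d + budget A m K

theorem crux_iff : DerivedPencilRolleQuasi ↔ ∃ C A, QCruxWith C A := by
  constructor
  · rintro ⟨C, A, h⟩
    exact ⟨C, A, fun m K S d hadm => h m K S d hadm.1 hadm.2.1 hadm.2.2⟩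
  · rintro ⟨C, A, h⟩
    exact ⟨C, A, fun m K S d hS hdet hd => h m K S d ⟨hS, hdet, hd⟩⟩

/-- **The pure quasi-polynomial root bound** (the crux with `C = 0`; by replication collapse and by the
triangular class the honest content of the crux). -/
def QuasiRootBound : Prop :=
  ∃ A : ℕ, ∀ (m K : ℕ) (S : Fin (K + 1) → Matrix (Fin m) (Fin m) ℝ) (d : Fin (K + 1) → ℕ),
    Admissible S d → posRoots S d ≤ budget A m K

/-- `QuasiRootBound → crux` (take `C = 0`). -/
theorem crux_of_quasiRootBound (h : QuasiRootBound) : DerivedPencilRolleQuasi := by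
  obtain ⟨A, hA⟩ := h
  refine ⟨0, A, fun m K S d hS hdet hd => ?_⟩
  rw [zero_mul, zero_add]
  exact hA m K S d ⟨hS, hdet, hd⟩

/-- Tower-simplicity: every positive root of `det` of the pencil AND of all its iterated derived pencils is
simple.  (Typed here only at the top level, which is what the halving step consumes; generic admissible
pencils satisfy it.) -/
def PosRootsSimple {m K : ℕ} (S : Fin (K + 1) → Matrix (Fin m) (Fin m) ℝ) (d : Fin (K + 1) → ℕ) : Prop :=
  ∀ t : ℝ, 0 < t → (∑ l, (X : ℝ[X]) ^ d l • (S l).map Polynomial.C).det.IsRoot t →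
    (∑ l, (X : ℝ[X]) ^ d l • (S l).map Polynomial.C).det.rootMultiplicity t = 1

/-- **Replication halving for the quasi budget** (census §F1; paper proof: block sum of `r = 2C` copies
`F + η_j X^{d 0} I` — derived pencil unchanged, simple positive roots persist and separate, size `2Cm`):
`QCruxWith C A` with `1 ≤ C` gives, for admissible pencils with simple positive roots,
`2C · Z₊(F) ≤ C · Z₊(∂F) + B(2Cm, K)`; iterating down the derived tower (the budget is monotone in `K`)
sums a geometric series (derived pencils keep size `m`): `Z₊(F) < B(2Cm,K)/C`.  So the Rolle multiplier carries no information. -/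
def ReplicationHalvingQ : Prop :=
  ∀ C A : ℕ, 1 ≤ C → QCruxWith C A →
    ∀ (m K : ℕ) (S : Fin (K + 1) → Matrix (Fin m) (Fin m) ℝ) (d : Fin (K + 1) → ℕ),
      Admissible S d → PosRootsSimple S d →
        2 * C * posRoots S d ≤ C * posRootsDerived S d + budget A (2 * C * m) K

/-! ## §2 The triangular class: the multiplier is idle; what a refutation must build -/

/-- The crux at fixed constants and fixed size (body = the crux's). -/
def QPencilBound (C A m : ℕ) : Prop :=
  ∀ (K : ℕ) (S : Fin (K + 1) → Matrix (Fin m) (Fin m) ℝ) (d : Fin (K + 1) → ℕ), (∀ l, (S l).IsSymm) →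
    (∀ l, (S l).det ≠ 0) → StrictMono d → posRoots S d ≤ C * posRootsDerived S d + budget A m K

theorem crux_iff_qPencilBound : DerivedPencilRolleQuasi ↔ ∃ C A : ℕ, ∀ m, QPencilBound C A m := Iff.rfl

/-- **Core (adapted verbatim from the tree's `triangular_bound_of_pencilBound`).** On the triangular class
(`T 0` invertible, `T l` upper triangular with positive diagonal for `l ≥ 1`, `d 0 = 0`) the symmetrisation
`[[0,T],[Tᵀ,δ•1]]` is a legal instance of size `k+k` whose DERIVED determinant never vanishes on `(0,∞)`, so
`QPencilBound C A (k+k)` is the ABSOLUTE bound `Z₊(det P) ≤ B(k+k, K)` on the class: `C` is idle. -/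
theorem triangular_quasiBound_of_qPencilBound (C A k K : ℕ) (T : Fin (K + 1) → Matrix (Fin k) (Fin k) ℝ)
    (d : Fin (K + 1) → ℕ) (hd0 : d 0 = 0) (hd : StrictMono d) (h0 : (T 0).det ≠ 0)
    (htri : ∀ l : Fin K, (T l.succ).BlockTriangular id) (hpos : ∀ (l : Fin K) (i : Fin k), 0 < T l.succ i i)
    (h : QPencilBound C A (k + k)) :
    ((∑ l, (X : ℝ[X]) ^ d l • (T l).map Polynomial.C).det.roots.toFinset.filter (fun t => 0 < t)).card ≤
      budget A (k + k) K := by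
  have hinst := h K (symS T) d (symS_isSymm T) (symS_det_ne_zero T h0 htri hpos) hd
  have hder : posRootsDerived (symS T) d = 0 := by
    unfold posRootsDerived
    rcases Nat.eq_zero_or_pos K with hK | hK
    · subst hK
      exact card_filter_roots_det_sum_fin_zero _ _
    · rw [Finset.card_eq_zero, Finset.filter_eq_empty_iff]
      intro t ht hpos_t
      rw [Multiset.mem_toFinset] at ht
      exact eval_det_derived_symS_ne_zero T d hd htri hpos hK t hpos_t (mem_roots'.1 ht).2
  rw [hder, mul_zero, zero_add] at hinst
  refine le_trans (Finset.card_le_card fun t ht => ?_) hinst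
  rw [Finset.mem_filter, Multiset.mem_toFinset] at ht ⊢
  obtain ⟨ht, htpos⟩ := ht
  have hPne := (mem_roots'.1 ht).1
  have hProot := (mem_roots'.1 ht).2
  refine ⟨mem_roots'.2 ⟨?_, ?_⟩, htpos⟩
  · intro hF
    apply hPne
    refine eq_zero_of_infinite_isRoot _ (Set.infinite_of_forall_exists_gt fun s => ⟨s + 1, ?_, by linarith⟩)
    have hev := congrArg (Polynomial.eval (s + 1)) hF
    rw [eval_det_symS T d hd0, Polynomial.eval_zero] at hev
    have hsq : (∑ l, (s + 1) ^ d l • T l).det = 0 := by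
      have := (mul_eq_zero.1 hev).resolve_left (pow_ne_zero _ (by norm_num))
      exact pow_eq_zero_iff (n := 2) (by norm_num) |>.1 this
    show IsRoot _ _
    rw [IsRoot.def, eval_det_pencil]
    exact hsq
  · rw [IsRoot.def, eval_det_symS T d hd0]
    rw [IsRoot.def, eval_det_pencil] at hProot
    rw [hProot]
    ring

/-- **H′ (what a refutation of the crux must construct).** For every `A`, a member of the triangular class
(an ABP over `K+1` lacunary monomials, up to a sign-preserving perturbation) whose determinant has MORE than
`B(2k, K) = (K+1)^{A K}·2^{(log₂(2k)+2)^A}` distinct positive roots.  Every tropical mechanism on file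
(Carstensen/Gajjar–Radhakrishnan bumps, the staircase) is capped at `2^{O(log² k)}` by Gusfield's bound and does
NOT reach it; a witness needs `log Z₊ = ω(K log K)` and `log Z₊ = (log k)^{ω(1)}` simultaneously (census §Negation). -/
def TriangularClassSuperQuasiRoots : Prop :=
  ∀ A : ℕ, ∃ (k K : ℕ) (T : Fin (K + 1) → Matrix (Fin k) (Fin k) ℝ) (d : Fin (K + 1) → ℕ),
    d 0 = 0 ∧ StrictMono d ∧ (T 0).det ≠ 0 ∧ (∀ l : Fin K, (T l.succ).BlockTriangular id) ∧
    (∀ (l : Fin K) (i : Fin k), 0 < T l.succ i i) ∧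
    budget A (k + k) K <
      ((∑ l, (X : ℝ[X]) ^ d l • (T l).map Polynomial.C).det.roots.toFinset.filter (fun t => 0 < t)).card

/-- **Negative lemma for the repaired crux (modulo H′).**  Any refutation goes through H′; conversely any proof
of the crux is, on the triangular class, a proof of the absolute bound `Z₊ ≤ B(2k,K)` with no Rolle term. -/
theorem derivedPencilRolleQuasi_false_of_H' (hH : TriangularClassSuperQuasiRoots) :
    ¬ DerivedPencilRolleQuasi := by
  intro h
  obtain ⟨C, A, hCA⟩ := crux_iff_qPencilBound.1 h
  obtain ⟨k, K, T, d, hd0, hd, h0, htri, hpos, hlt⟩ := hH A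
  exact absurd (triangular_quasiBound_of_qPencilBound C A k K T d hd0 hd h0 htri hpos (hCA (k + k)))
    (not_le.2 hlt)

/-! ## §3 Strengthenings and fences typed for the census -/

/-- **S1 (FALSE on paper — census §Strengthen S2).** The bilinear shape `log Z₊ = O(log m · log K)` in the
crux's own class (the sibling census's `MatrixDescartesLogK`; its semidefinite form is the sibling line's
`stub_bmd`).  Exponent binarisation of the Carstensen/Gajjar–Radhakrishnan bump ABP (size `poly n`,
`Z = 2^{Θ(log² n)}`) leaves only `O(log³ n)` distinct monomials, and GKKP symmetrisation keeps `det = c·f`: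
then `a (log m+1)(log K+1) = O(a log n · log log n) ≪ log² n`. -/
def BilinearLaw : Prop :=
  ∃ a : ℕ, ∀ (m K : ℕ) (S : Fin (K + 1) → Matrix (Fin m) (Fin m) ℝ) (d : Fin (K + 1) → ℕ),
    Admissible S d → posRoots S d ≤ 2 ^ (a * (Nat.log 2 m + 1) * (Nat.log 2 (K + 1) + 1))

/-- **S3 (binarisation-proof bilinear shape; implies the crux, consistent with every family on file).**
`log Z₊ = O((log m + 1)·(log m + log K + 2))` — bilinear in `(log m, log(mK))`: binarised bumps
(`m = poly n`, `K = polylog n`, `log Z = Θ(log² n)`), un-binarised bumps, Vinnikov `K = 2` (`Z ~ m²/2`),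
`m = 2` (`Z ~ K²/2`), the staircase (`Z = n^L`, `m = 2^{6L}n^6`, `K = L+1`) all sit inside.  It implies the
crux (`a x² + a x y ≤ x^A + A K log(K+1)`-type arithmetic) and the sibling's `MatrixDescartes`.  Recorded, not
filed: a single stronger stub in the crux's own class has no why-easier (census Λ-list); the line files the
sign-variation form instead. -/
def LogMLogMKLaw : Prop :=
  ∃ a : ℕ, ∀ (m K : ℕ) (S : Fin (K + 1) → Matrix (Fin m) (Fin m) ℝ) (d : Fin (K + 1) → ℕ),
    Admissible S d →
      posRoots S d ≤ 2 ^ (a * (Nat.log 2 m + 1) * (Nat.log 2 m + Nat.log 2 (K + 1) + 2))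

/-- **S4 (DEAD).** "The number of sign changes of the COEFFICIENT SEQUENCE of `det F` (ordered by exponent) is
within the budget" — would give the crux by Descartes' rule (`Polynomial.signVariations`), and is false:
`F = diag(g,…,g)` (`ℓ` copies) with `g = X^{d_0} − X^{d_1} + X^{d_2} − ⋯`, `d_l = B^l`, has
`det F = g^ℓ` whose coefficients alternate in sign at EVERY consecutive pair of exponents
(`≈ C(ℓ+K,K)` sign changes, far above `K^{AK}·2^{polylog ℓ}` for `K² ≪ ℓ`) while `Z₊(det F) = Z₊(g) ≤ K`.
So any proof must see cancellation, not coefficient signs. -/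
def CoeffSignLaw : Prop :=
  ∃ A : ℕ, ∀ (m K : ℕ) (S : Fin (K + 1) → Matrix (Fin m) (Fin m) ℝ) (d : Fin (K + 1) → ℕ),
    Admissible S d →
      ((∑ l, (X : ℝ[X]) ^ d l • (S l).map Polynomial.C).det.support.card ≤ budget A m K ∨
        True) -- placeholder disjunct: the informal statement is about `signVariations` of the coefficient
             -- list; typed loosely here because only its falsity (by the explicit family above) is used.

/-- **Fence 1 (support target, provable now from the Descartes/monomial count).** Few terms are free:
`det F` has at most `C(m+K, K)` monomials (exponents are sums of `m` elements of `{d_l}`), so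
`Z₊ < C(m+K,K) ≤ 2^{K·(log₂(m+K)+2)}`, which is inside the budget whenever `K ≤ A'·(log₂ m + 1)`:
for such `K` the crux holds with `C = 0` and `A = A' + 3`. -/
def FewTermsFree : Prop :=
  ∀ A' : ℕ, ∀ (m K : ℕ) (S : Fin (K + 1) → Matrix (Fin m) (Fin m) ℝ) (d : Fin (K + 1) → ℕ),
    Admissible S d → K ≤ A' * (Nat.log 2 m + 1) → posRoots S d ≤ budget (A' + 3) m K

/-- **Fence 2 (support target, provable now).** Many terms are free: if `(K+1)^{A+1} ≥ 2e(m+K)`-ish — typed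
as `m + K ≤ (K+1)^A` — then the Descartes count `C(m+K,K) ≤ (m+K)^K ≤ (K+1)^{A K}` is already inside the budget. -/
def ManyTermsFree : Prop :=
  ∀ A : ℕ, ∀ (m K : ℕ) (S : Fin (K + 1) → Matrix (Fin m) (Fin m) ℝ) (d : Fin (K + 1) → ℕ),
    Admissible S d → m + K ≤ (K + 1) ^ A → posRoots S d ≤ budget A m K

/-- The content regime of the crux is what the two fences leave: `A'·log₂ m < K` and `(K+1)^A < m + K`
(few-but-not-logarithmically-few distinct monomials); the route's regime `log₂ m = c(log₂ K+1)²` is inside. -/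
theorem fences_note : True := trivial

end Summit.ValiantsHypothesis.ValiantsHypothesis.Cruxes.DerivedPencilRolleQuasi.Strategy
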